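import Summits.BirchSwinnertonDyer.BirchSwinnertonDyer.Theses.SignedLowerHalves
import Summits.BirchSwinnertonDyer.BirchSwinnertonDyer.Theses.PrintX8VS
import Literature.NumberTheory.EllipticCurves.KuriharaNumber
import Literature.NumberTheory.EllipticCurves.KatoKolyvaginPrimes
import Literature.NumberTheory.EllipticCurves.Tamagawa
import HarnessLib

/-!
# Line `kurihara-digit` for crux K1 `SprungLowerDivisibilityAtThree` (item stmt-BirchSwinnertonDyer-19875)

Crux (FIXED; routes `SignedLowerHalves` #3 / `PrintX8VS` #1 — D-0152: this feeds a CLASS route; BSD is NOT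
proved by anything here): `K1 = ∀ W p, ClassX8 W p → ∀ •, Theorems.SprungSharpFlatLowerDivisibility W p •`, the
Eisenstein half `(ϖ·L^•) ∣ gen(char X^•)·h` of Sprung's ♯/♭ main conjecture at `(3, a₃ = ±3)`.

## The lever (proof strategy: RESIDUAL KOLYVAGIN-SYSTEM PRIMITIVITY CERTIFIED BY ONE TWISTED L-VALUE DIGIT —
## horizontal, at tame Kolyvagin primes; no Coleman-map extension, no anchor/transfer, no Heegner field,
## no homological span)

For `E ∈ X8` with 3-adically surjective image, Kato's `Λ`-adic Kolyvagin system `κ^∞` lives in a FREE RANK-ONE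
module (Büyükboduk; at `p = 3` via Sakamoto 2024, tree `Sakamoto2024.kolyvaginSystems_freeRankOne_zmod_three_pow`),
so `κ^∞ = g·κ^{pr}` for ONE power series `g ∈ Λ = ℤ₃⟦X⟧`, and BOTH chromatic main conjectures (with `μ`, both
colours, every height-one prime at once) are equivalent to `g ∈ Λˣ`, i.e. to ONE 3-adic digit: `ord₃ g(0) = 0`.
Kim's dictionary (arXiv:2203.12159 Thm. 1.4/1.11, `E(ℚ₃)[3] = 0` — automatic on X8 since `#Ẽ(𝔽₃) ∈ {1, 7}`) reads
that digit off the KURIHARA NUMBERS `δ̃_n = Σ_{a ∈ (ℤ/n)ˣ} [a/n]⁺_f · Π_{ℓ∣n} log_{η_ℓ}(a)` (tree `kuriharaNumber`):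
`g ∈ Λˣ ⟺ ∃ n ∈ 𝒩_k : ord₃ δ̃_n^{(k)} = t_E`, `t_E := ord₃ ∏_ℓ c_ℓ(E)` (the Tamagawa defect; `t_E = 0` is the
residual case `δ̃_n ≢ 0 (mod 3)`, Kurihara–Kim–Kim Thm. 1.1, whose Example 8.2.2 is the X8 curve 760.? at `p = 3`).
For a Kolyvagin PRIME `ℓ` (`ℓ ≡ 1`, `a_ℓ ≡ 2 (mod 3)`) and the cubic character `χ_ℓ` of conductor `ℓ`,
`L^{alg}(E, χ_ℓ) ≡ (ζ₃ − 1)·δ̃_ℓ (mod 3)` in `ℤ₃[ζ₃]`: the Kurihara number is the `(1−ζ₃)`-adic DIGIT of a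
cubic-twist L-value just beyond the forced Eisenstein congruence. THE ENGINE (stub A) is therefore a HORIZONTAL
mod-`𝔭` NON-VANISHING statement for twisted L-values over a Chebotarev set of prime conductors — the type of
statement attacked by residual equidistribution of modular symbols (Lee–Sun, JEMS, arXiv:1902.06277 Thm. 1 /
Cor. 3.8 prove the one-digit-weaker cousin `#{χ mod n ≤ M : L_E(χ) ≢ 0 mod 𝔭^{1+v_𝔭(φ(n))}} ≫ M`), by
Mazur–Rubin statistics (arXiv:1910.12798) and by moments of additive twists — none of which has been pointed at
`(3, a₃ = ±3)`, where NO p-adic-L-function-side tool exists. Zero-one law: by rank-one rigidity the digit set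
`{n : δ̃_n^{(k)} sharp}` is EMPTY or an explicit infinite Chebotarev-structured set, so ANY density / Ω-result
for the digit decides the main conjecture for that curve; per curve it is a finite modular-symbol computation.

Stub B (bridge) = [Kim Thm. 1.4 ⟸ direction + Büyükboduk `Λ`-adic KS + Mazur–Rubin 5.3.10(iii)] at `p = 3`
(the `p ≥ 5` in print is only MR's (H.4); Sakamoto 2024 supplies rank-one rigidity over every zero-dimensional
Gorenstein quotient `S_𝔓/𝔪^k`, `3^α S = 0`, which is what the `Λ`-adic specialisation argument consumes), then
Kato's IMC `char(𝐇¹/Z) = char(X₀)` ⟹ BOTH ♯/♭ main conjectures by the four-term identity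
`length_𝔭 X^• + length_𝔭(𝐇¹/Z) = length_𝔭 X₀ + length_𝔭 Λ/(ϖL^•)` (tree
`SharpFlatColemanKatoData.lengthAt_add_eq`, Sprung 2012 Prop. 7.19) and Thm. 7.14 torsion; for `t_E > 0` it
also needs Büyükboduk's Question 1 (JNT 129 (2009) §4.2: the defect is the FULL Tamagawa product) — declared open.
Stub R (residual, NOT claimed by this line): the X8 classes whose 3-adic image is not surjective
(barrier `EulerSystemBigImageAtSmallImage`), supplied by the image-free lines (`vertical-kato-generator`,
`chromatic-common-zeros`, `dihedral-elliptic-unit-anchor`).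

Disproof.lean (v3, NO KILL) honoured: the GUARD `L^• ≠ 0` stays a binder of K1 and is used by stub B through
`colMap_injective` (`Negative/GuardAndTorsion`: `conclusion_false_of_chromaticL_eq_zero` — we never conclude on a
colour with `L^• = 0`); TORSION (`isTorsion_of_sprungLowerDivisibilityAtThree`) is delivered, not assumed: stub B
concludes the FULL `SprungSharpFlatMainConjecture` (torsion conjunct included, from Kato 12.4 + Thm. 7.14), and K1
follows with `h = 1` (proved below, two lines). No `_false_without_` theorem exists for this crux; no stub is an
instance of a landed Negative lemma (`not_lowerShape_zero`: our `gen` is `G₁ ≠ 0`). Dead line avoided: Sprung 2024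
Thm. 1.1 («… and that Conjecture 3.33 holds») is NOT invoked; no Beilinson–Flach class, no two-variable input.
-/

set_option autoImplicit false
-- the problem directory `BirchSwinnertonDyer/BirchSwinnertonDyer` forces the duplicated namespace segment
set_option linter.dupNamespace false

noncomputable section

open scoped Classical NumberField MatrixGroups ModularForm

open NumberField IsDedekindDomain CongruenceSubgroup WeierstrassCurve
  Literature.NumberTheory.EllipticCurves Literature.NumberTheory.EllipticCurves.ModularForms
  Literature.NumberTheory.EllipticCurves.ZpExtension Literature.NumberTheory.EllipticCurves.Sprung2017
  Literature.NumberTheory.EllipticCurves.Sprung2012 Literature.NumberTheory.EllipticCurves.Rank1Residual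
  Summit.BirchSwinnertonDyer.BirchSwinnertonDyer.Theorems

namespace Summit.BirchSwinnertonDyer.BirchSwinnertonDyer.Cruxes.SprungLowerDivisibilityAtThree

namespace KuriharaDigit

/-! ## Vocabulary (all tree declarations; two abbreviations for readability) -/

/-- `E` has 3-adically (tower-)surjective image: `ρ_{E,p^m}` onto `GL₂(ℤ/p^m)` for every `m`
(the hypothesis of route `KimAtThreeKolyvagin`; on X8 it fails exactly on the 61 small-image classes). -/
def TowerSurjective (W : WeierstrassCurve ℚ) (p : ℕ) : Prop :=
  ∀ m : ℕ, W.HasSurjectiveModNGaloisRep (p ^ m : ℕ)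

/-- The **Tamagawa depth** `t_E = ord_p ∏_ℓ c_ℓ(E)` (Kim 2022 Conj. 1.10: `∂^{(∞)}(δ̃) = Σ_ℓ ord_p c_ℓ`). -/
def tamagawaDepth (W : WeierstrassCurve ℚ) [W.IsElliptic] (p : ℕ) : ℕ :=
  padicValNat p W.tamagawaProduct

/-- **The sharp Kurihara digit** for a newform `f` of `W` at `p`: some square-free product `n` of Kolyvagin
primes of level `k > t_E` (tree `Kato.IsKolyvaginProduct`) and surjective discrete logarithms `ψ_ℓ` have
`δ̃_n^{(k)} = kuriharaNumber f (p^k) n ψ ∉ p^{t_E+1}·(ℤ/p^k)`, i.e. `ord_p δ̃_n^{(k)} ≤ t_E` (`= t_E` is then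
forced by Büyükboduk's defect). For `t_E = 0`: a Kurihara number that is non-zero mod `p` (KKS Thm. 1.1's input). -/
def HasSharpKuriharaDigit (W : WeierstrassCurve ℚ) [W.IsElliptic] [W.IsGloballyMinimal] (p : ℕ)
    {N : ℕ} (f : CuspForm (Gamma0 N) 2) : Prop :=
  ∃ (k n : ℕ) (_ : NeZero n), tamagawaDepth W p < k ∧ Kato.IsKolyvaginProduct W p k n ∧
    ∃ ψ : (ℓ : ℕ) → (ZMod ℓ)ˣ →* Multiplicative (ZMod (p ^ k)),
      (∀ ℓ ∈ n.primeFactors, Function.Surjective (ψ ℓ)) ∧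
      ¬ ((p : ZMod (p ^ k)) ^ (tamagawaDepth W p + 1) ∣ kuriharaNumber f (p ^ k) n ψ)

/-! ## The three stubs -/

/-- **stub A — THE ENGINE (open; the idea): every 3-adically surjective X8 curve has a sharp Kurihara digit.**
For `t_E = 0` (3 ∤ ∏ c_ℓ): some `δ̃_n ≢ 0 (mod 3)`; at a Kolyvagin prime `n = ℓ` this says the cubic-twist value
`L^{alg}(E,χ_ℓ)` has `(1−ζ₃)`-adic valuation exactly `1` — a horizontal mod-`𝔭` non-vanishing statement over
the Chebotarev set `{ℓ ≡ 1 (3), a_ℓ ≡ 2 (3)}` (density > 0), decidable per pair by a finite modular-symbol sum.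
Why plausibly true: it is EQUIVALENT (given stub B's inputs) to the ♯/♭ main conjectures for `E` (Kim Thm. 1.11
form), verified numerically for every tested curve (KKS Cor. 1.7: all optimal `E`, `N < 30000`, `p ≥ 5` with
`Ш[p] ≠ 0`; KKS Ex. 8.2.2: the X8 curve of conductor 760 at `p = 3`, `δ̃₁ = 2`); Lee–Sun prove the one-digit
weaker average version. Why it might fail: only together with the main conjecture itself (zero-one law); as a
PROOF target the Chebotarev restriction to prime conductors is beyond current dynamical methods. Size XL.
[cite: KimKimSun2020Selecta, Thm. 1.1, Ex. 8.2.2] [cite: Kim2022StructureSelmer, Thm. 1.11, Conj. 1.10]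
[cite: LeeSun2019JEMS, Thm. 1, Cor. 3.8] [cite: MazurRubin2019Statistics] -/
theorem stub_kuriharaDigit :
    ∀ (W : WeierstrassCurve ℚ) [W.IsElliptic] [W.IsGloballyMinimal] (p : ℕ) [Fact p.Prime],
      ClassX8 W p → TowerSurjective W p →
      ∀ (N : ℕ) (_ : NeZero N) (f : CuspForm (Gamma0 N) 2) (ϖ : ℚ),
        IsNewformOf W f → (ϖ : ℝ) * W.realPeriodRat = plusPeriod f →
        HasSharpKuriharaDigit W p f := by
  sorry

/-- **stub B — THE BRIDGE (print-adjacent at `t_E = 0`, size L; needs Büyükboduk's Question 1 at `t_E > 0`):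
a sharp Kurihara digit gives BOTH ♯/♭ main conjectures on X8.** Route: (B1) Kim's dictionary
`ord δ̃_n^{(k)} ↔ ∂(κ^{Kato}_n)` (Thm. 1.4/Lemma 3.14; `E(ℚ_p)[p] = 0` holds on X8 as `#Ẽ(𝔽₃) ∈ {1,7}`; Manin
constant prime to 3 at a good prime) ⟹ `∂^{(∞)}(κ^{Kato}) ≤ t_E`; (B2) Büyükboduk's `Λ`-adic Kolyvagin systems
(KKS Thm. 4.15/Prop. 4.19: `KS(T ⊗ Λ)` free of rank one, specialisation defect `= t_E` — equality for several
`p ∣ c_ℓ` is Büyükboduk JNT 2009 Question 1, OPEN) ⟹ `κ^{Kato,∞} = unit · generator`, i.e. `Λ`-primitive;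
(B3) Mazur–Rubin Thm. 5.3.10 (iii) ⟹ Kato's IMC `char_Λ(𝐇¹/Z) = char_Λ(X₀)` — at `p = 3` the hypothesis (H.4)
`p > 4` is replaced by Sakamoto 2024 (tree `Sakamoto2024.kolyvaginSystems_freeRankOne_zmod_three_pow`,
`…_idealOfBasis_eq_fittingIdeal_zmod_three_pow`) run over the zero-dimensional Gorenstein quotients of the
`S_𝔓`; (B4) the four-term identity `SharpFlatColemanKatoData.lengthAt_add_eq` (Sprung Prop. 7.19) at every
height-one `𝔭` for each colour with `L^• ≠ 0` (GUARD used: `colMap_injective`) turns `length(𝐇¹/Z) = length X₀`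
into `length X^• = length Λ/(ϖL^•)`, i.e. `char X^• = (ϖL^•)`, torsion from Thm. 7.14 / Kato 12.4. Why it might
fail: (B2)'s defect equality at `t_E > 0` with ≥ 2 Tamagawa numbers divisible by 3; the `p = 3` port of (B3).
[cite: Kim2022StructureSelmer, Thm. 1.4, Thm. 1.11, §5] [cite: KimKimSun2020Selecta, Thm. 4.15, Prop. 4.19,
Thm. 4.20] [cite: Buyukboduk2009TamagawaDefect, Thm. A, Question 1] [cite: MazurRubin2004, Thm. 5.3.10]
[cite: Sakamoto2024JTNB, Thm. 1.1, Thm. 4.4] [cite: Sprung2012, Thm. 7.14, Prop. 7.19] -/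
theorem stub_mainConjecture_of_kuriharaDigit :
    ∀ (W : WeierstrassCurve ℚ) [W.IsElliptic] [W.IsGloballyMinimal] (p : ℕ) [Fact p.Prime],
      ClassX8 W p → TowerSurjective W p →
      ∀ (N : ℕ) (_ : NeZero N) (f : CuspForm (Gamma0 N) 2) (ϖ : ℚ),
        IsNewformOf W f → (ϖ : ℝ) * W.realPeriodRat = plusPeriod f →
        HasSharpKuriharaDigit W p f →
        ∀ col : Chroma, SprungSharpFlatMainConjecture W p col := by
  sorry

/-- **stub R — RESIDUAL, not claimed by this line: K1 on the X8 classes whose 3-adic image is NOT surjective**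
(61 classes in the x8 census; barrier `EulerSystemBigImageAtSmallImage`
(`not_katoBigImageHypothesis_of_irr_of_not_surj`) forbids any Kolyvagin-system bridge there). Suppliers named:
the image-free lines `vertical-kato-generator` (GEN certificate), `chromatic-common-zeros`,
`dihedral-elliptic-unit-anchor`. Why it might fail: it is K1 itself on the small-image locus. Size XL.
[cite: Sprung2012, Thm. 1.3] [cite: Kato2004Asterisque, Thm. 17.4] -/
theorem stub_nonTowerSurjective :
    ∀ (W : WeierstrassCurve ℚ) [W.IsElliptic] [W.IsGloballyMinimal] (p : ℕ) [Fact p.Prime],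
      ClassX8 W p → ¬ TowerSurjective W p →
      ∀ col : Chroma, SprungSharpFlatLowerDivisibility W p col := by
  sorry

/-! ## Sorry-free glue: the main conjecture gives the lower divisibility with `h = 1` -/

/-- `SprungSharpFlatMainConjecture W p • → SprungSharpFlatLowerDivisibility W p •` (take `h = 1`). -/
theorem lowerDivisibility_of_mainConjecture (W : WeierstrassCurve ℚ) [W.IsElliptic] [W.IsGloballyMinimal]
    (p : ℕ) [Fact p.Prime] (col : Chroma) (hMC : SprungSharpFlatMainConjecture W p col) :
    SprungSharpFlatLowerDivisibility W p col := by
  intro κ γ hκ hγ hcv v hv g hg cneg c hH N hN f ϖ Lsharp Lflat hf hϖ hSP hcol D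
  obtain ⟨_, gen, hgen, hι⟩ := hMC κ γ hκ hγ hcv v hv g hg cneg c hH N hN f ϖ Lsharp Lflat hf hϖ hSP hcol D
  exact ⟨gen, 1, hgen, by simpa using hι⟩

/-! ## The composition (sorry-free): K1 from stubs A, B, R BY NAME -/

/-- K1's body for one X8 pair and one colour. -/
theorem lowerDivisibility_of_stubs (W : WeierstrassCurve ℚ) [W.IsElliptic] [W.IsGloballyMinimal] (p : ℕ)
    [Fact p.Prime] (hX : ClassX8 W p) (col : Chroma) : SprungSharpFlatLowerDivisibility W p col := by
  by_cases hS : TowerSurjective W p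
  · intro κ γ hκ hγ hcv v hv g hg cneg c hH N hN f ϖ Lsharp Lflat hf hϖ hSP hcol D
    have hA : HasSharpKuriharaDigit W p f := stub_kuriharaDigit W p hX hS N hN f ϖ hf hϖ
    have hMC : SprungSharpFlatMainConjecture W p col :=
      stub_mainConjecture_of_kuriharaDigit W p hX hS N hN f ϖ hf hϖ hA col
    exact lowerDivisibility_of_mainConjecture W p col hMC κ γ hκ hγ hcv v hv g hg cneg c hH N hN f ϖ
      Lsharp Lflat hf hϖ hSP hcol D
  · exact stub_nonTowerSurjective W p hX hS col

/-- **THE SKELETON**: the crux decl of route `SignedLowerHalves` BY NAME, no hypotheses, from the stubs. -/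
theorem SprungLowerDivisibilityAtThree_of :
    Summit.BirchSwinnertonDyer.BirchSwinnertonDyer.Theses.SignedLowerHalves.SprungLowerDivisibilityAtThree := by
  intro W _ _ p _ hX col
  exact lowerDivisibility_of_stubs W p hX col

/-- The same skeleton for the identical decl of route `PrintX8VS` (item 19875 is shared by both routes). -/
theorem SprungLowerDivisibilityAtThree_of_printX8VS :
    Summit.BirchSwinnertonDyer.BirchSwinnertonDyer.Theses.PrintX8VS.SprungLowerDivisibilityAtThree := by
  intro W _ _ p _ hX col
  exact lowerDivisibility_of_stubs W p hX col

end KuriharaDigit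

end Summit.BirchSwinnertonDyer.BirchSwinnertonDyer.Cruxes.SprungLowerDivisibilityAtThree

end
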